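import Summits.CriticalPhenomena.PercolationContinuityZ3.Theses.PercNearOneGluing
import Literature.Probability.Percolation.PercolationProofs
import Literature.Probability.Percolation.ConditionalPositiveAssociationProofs
import Literature.Probability.Percolation.TwoClusterConditionalAssociationProofs
import Summits.CriticalPhenomena.PercolationContinuityZ3.Theorems.PercNearOneGluingAdditiveGluingGoodBase
import Summits.CriticalPhenomena.PercolationContinuityZ3.Theorems.PercNearOneGluingAdditiveGluingGoodTwoRelays
import Summits.CriticalPhenomena.PercolationContinuityZ3.Theorems.PercNearOneGluingAdditiveGluingLemma5AnyRelay
import Summits.CriticalPhenomena.PercolationContinuityZ3.Theorems.PercNearOneGluingAdditiveGluingGoodStep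

/-! TTRL-lite variant V1993 of stmt-CriticalPhenomena-4576

(move `small_case`, op `card_eq:A=4`: assume `A.card = 4`).  The variant's hypotheses are jointly
contradictory: `A.card = 4` and `b ∈ A` give `(A.erase b).card = 3` (`Finset.card_erase_of_mem`),
against the hypothesis `4 ≤ (A.erase b).card`.  The statement therefore holds vacuously; no new
definitions, no named facts. -/

namespace Summit.CriticalPhenomena.PercolationContinuityZ3.Theorems

open MeasureTheory Literature.Probability.LatticeModels Literature.Probability.Percolation
open scoped Classical BigOperators

/-- TTRL-lite variant V1993 of stmt-CriticalPhenomena-4576 (additive gluing, small case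
`A.card = 4`).  Vacuous: with `b ∈ A` and `A.card = 4` the erased relay set `A.erase b` has
exactly `3` elements, contradicting the hypothesis `4 ≤ (A.erase b).card`. -/
theorem additiveGluing_var1993 : ∀ (n : ℕ) (w : Sym2 (Fin n) → unitInterval) (A : Finset (Fin n)) (o b : Fin n) (t : ℝ), A.card = 4 → b ∈ A → 0 < t → (∀ a ∈ A, 1 - t ≤ (prodBernoulli w).real (openConn a b)) → (∃ a₀ ∈ A, ∃ a₁ ∈ A, ∃ a₂ ∈ A, a₀ ≠ a₁ ∧ a₀ ≠ a₂ ∧ a₁ ≠ a₂ ∧ (prodBernoulli w).real (openConn a₀ b) = 1 - t ∧ (prodBernoulli w).real (openConn a₁ b) = 1 - t ∧ (prodBernoulli w).real (openConn a₂ b) = 1 - t) → 4 ≤ (A.erase b).card → ∑ W : Finset (Fin n), ∑ N : Finset (Fin n), (prodBernoulli w).real {ω : BondConfig (Fin n) | (Finset.univ.filter fun v => ω ∈ openConnIn ((↑A : Set (Fin n))ᶜ) o v) = W ∧ (A.filter fun a => ω ∈ openConnIn (insert a ((↑A : Set (Fin n))ᶜ)) o a) = N} * (if N.Nonempty then 1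 - (prodBernoulli (fun e : Sym2 (Fin n) => if ∃ v ∈ W, v ∈ e then (0 : unitInterval) else w e)).real (⋃ a ∈ N, openConn a b) else 0) ≤ t := by
  intro n w A o b t hA hb _ _ _ hcard
  -- `(A.erase b).card = A.card - 1 = 3`, contradicting `4 ≤ (A.erase b).card`
  rw [Finset.card_erase_of_mem hb, hA] at hcard
  omega

end Summit.CriticalPhenomena.PercolationContinuityZ3.Theorems
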